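import Literature.AlgebraicGeometry.KTheory.CoherentEulerCharacteristic
import Literature.AlgebraicGeometry.HodgeTheory.SemiregularVariationalHodgeTwistedPerfect
import Literature.AlgebraicGeometry.Motives.JacobianAbelJacobiTranslates
import Literature.AlgebraicGeometry.Modules.ExtensionContraction
import HarnessLib

/-!
# The Chern character of a coherent sheaf with a finite locally free resolution

For a complex variety `X` (a `SchemeOver ℂ`), a Chern character `C : ChernCharacterBetti`
(`HodgeTheory/ChernCharacterBetti`: `ch_k(E) ∈ H^{2k}(X(ℂ); ℂ)` on vector bundles, additive on short exact
sequences), a coherent sheaf `F` on `X` and a finite locally free resolution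
`0 → ℰ_n → ⋯ → ℰ_0 → F → 0` (a `Modules.StrictlyPerfectResolution F`), the **Chern character of `F`** is
`ch_k(F) := Σᵢ (−1)ⁱ ch_k(ℰ_i)` — the value on the class `[F] = Σ(−1)ⁱ[ℰ_i] ∈ K₀(X)`
(`KTheory.KZero.ofCoh F R`, `KTheory/CoherentEulerCharacteristic`) of the additive extension
`ch_k : K₀(X) →+ H^{2k}` (`chKZero`, `HodgeTheory/SemiregularVariationalHodgeTwistedPerfect` §1); Fulton,
*Intersection Theory* §15.1 with App. B.8.3 ("on a non-singular variety `K°X ≅ K°X`, so `ch` is defined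
on coherent sheaves"), Hartshorne III Ex. 6.9. As for `KZero.ofCoh`, the resolution is an ARGUMENT of
the definition (no choice is made); independence of it is a theorem under the named fact
`KTheory.Hartshorne1977_eulerChar_resolution_shortExact` (Hartshorne III Ex. 6.9 (b)).

## What is typed (namespace `Literature.AlgebraicGeometry.HodgeTheory`)

* `chCoh C X F R k := chKZero C X k (KZero.ofCoh F R)` (`= chPerfect C X R.P _ k`, `chCoh_eq_chPerfect`, `rfl`);
* PROVED, on ANY `X`: `chCoh_ofFiniteLocallyFree` (`ch_k` of a vector bundle on its trivial resolution
  is `C.ch`), `chCoh_eq_of_hom` (resolutions related by a map over `F`), rationality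
  `isRationalClass_chCoh`, algebraicity on smooth projective `X` (`chCoh_mem_algebraicClasses`),
  **`chCoh_cone : ch_k(F₃) = ch_k(E) − ch_k(F₁)`** on the cone resolution of a quotient `F₃ = E/F₁` of a
  vector bundle, and its ideal-sheaf instance **`chCoh_pushforward_unit_cone :
  ch_k(ι_*𝒪_Z) = ch_k(𝒪_X) − ch_k(𝓘_Z)`** (closed immersion `ι : Z → X`, ANY resolution of `𝓘_Z`,
  `ι_*𝒪_Z` on the cone resolution);
* under the fact `h : Hartshorne1977_eulerChar_resolution_shortExact` on a noetherian, integral,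
  separated, regular `X`: `chCoh_eq` (resolution independence), `chCoh_shortExact` (additivity on short
  exact sequences of coherent sheaves), `chCoh_eq_ch` (a vector bundle, any resolution),
  **`chCoh_idealSheafOf_eq : ch_k(𝓘_Z) = ch_k(𝒪_X) − ch_k(ι_*𝒪_Z)`** on ANY resolutions;
* the specialisations to an abelian variety `A` over `ℂ` (its hypotheses noetherian / integral /
  separated / regular are DISCHARGED: `Motives/JacobianAbelJacobiTranslates.AbelianVariety.isRegular_left`
  etc.) — `AbelianVariety.chCoh_eq`, `AbelianVariety.chCoh_shortExact`, `AbelianVariety.chCoh_idealSheafOf_eq` —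
  and to the ideal sheaf `𝓘_𝒵 = Jacobian.ajTranslatesIdeal P S` of a finite union of translates of an
  Abel–Jacobi curve in its Jacobian (`Jacobian.chCoh_ajTranslatesIdeal_cone`, fact-free on the cone
  resolution; `Jacobian.chCoh_ajTranslatesIdeal_eq` under the fact).

Not here: `ch` of a coherent sheaf WITHOUT a given resolution (needs the existence fact
`Modules.Hartshorne1977_exists_strictlyPerfectResolution` and a choice), Grothendieck–Riemann–Roch for `ι_*`,
the Chern character of `ι_*𝒪_Z` in terms of `Z` (Fulton Example 15.2.16 / Thm. 15.2). No instance, no notation.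

## References

* W. Fulton, *Intersection Theory*, 2nd ed. (1998), §15.1, Example 15.1.5, App. B.8.3. [Fulton1998]
* R. Hartshorne, *Algebraic Geometry*, GTM 52 (1977), III Ex. 6.9 (p. 238–239), II Prop. 5.9. [Hartshorne1977]
* J. S. Milne, *Jacobian varieties*, in Cornell–Silverman (1986), §2 Prop. 2.3. [Milne1986JacobianVarieties]
-/

noncomputable section

open CategoryTheory CategoryTheory.Limits AlgebraicGeometry
open Literature.AlgebraicGeometry.KTheory

namespace Literature.AlgebraicGeometry.HodgeTheory

open Literature.AlgebraicGeometry.Motives Literature.AlgebraicGeometry.Modules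
  Literature.AlgebraicGeometry.Morphisms Literature.AlgebraicGeometry.Resolution

/-! ### §1 `ch_k` of a coherent sheaf on a given resolution -/

section ChernCharacterCoherent

variable (C : ChernCharacterBetti) (X : SchemeOver ℂ)

/-- **The Chern character of a coherent sheaf `F` on a finite locally free resolution `R`**, degree `k`:
`ch_k(F) = Σᵢ (−1)ⁱ ch_k(R.Pⁱ) = ch_k([F])`, `[F] = χ(R.P) ∈ K₀(X)` (`KZero.ofCoh F R`). The resolution is
an argument; see `chCoh_eq` for independence. [cite: Fulton1998, §15.1 (with App. B.8.3)] -/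
def chCoh (F : X.left.Modules) (R : StrictlyPerfectResolution F) (k : ℕ) : complexBetti X (2 * k) :=
  chKZero C X k (KZero.ofCoh F R)

/-- Unfolding. [cite: Fulton1998, §15.1] -/
theorem chCoh_def (F : X.left.Modules) (R : StrictlyPerfectResolution F) (k : ℕ) :
    chCoh C X F R k = chKZero C X k (KZero.ofCoh F R) := rfl

/-- `ch_k(F)` on `R` is the Chern character `chPerfect` of the resolving complex `R.P` (definitionally).
[cite: Fulton1998, §15.1] -/
theorem chCoh_eq_chPerfect (F : X.left.Modules) (R : StrictlyPerfectResolution F) (k : ℕ) :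
    chCoh C X F R k = chPerfect C X R.P R.isBoundedVB.isFiniteLocallyFree k := rfl

/-- **Alternating sum**: `ch_k(F) = Σ_{i ∈ s} (−1)ⁱ ch_k(R.Pⁱ)` for any finite set `s` of degrees off which
the resolving complex vanishes. [cite: Fulton1998, §15.1 and Example 3.2.3] -/
theorem chCoh_eq_sum (F : X.left.Modules) (R : StrictlyPerfectResolution F) (s : Finset ℤ)
    (hs : ∀ i ∉ s, IsZero (R.P.X i)) (k : ℕ) :
    chCoh C X F R k = ∑ i ∈ s, ((i.negOnePow : ℤˣ) : ℤ) • C.ch X (R.P.X i) k :=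
  chPerfect_eq_sum C X R.P _ s hs k

/-- **On the trivial resolution `E[0]` of a vector bundle, `ch_k(E)` is the Chern character of `E`.**
[cite: Fulton1998, §15.1 and Example 3.2.3] -/
theorem chCoh_ofFiniteLocallyFree (E : X.left.Modules) (hE : IsFiniteLocallyFree E) (k : ℕ) :
    chCoh C X E (StrictlyPerfectResolution.ofFiniteLocallyFree hE) k = C.ch X E k := by
  rw [chCoh_def, KZero.ofCoh_ofFiniteLocallyFree, chKZero_of]

/-- Two resolutions related by a morphism of complexes over `F` give the same `ch_k(F)` (the morphism is
a quasi-isomorphism; `KZero.ofCoh_eq_of_hom`). [cite: Fulton1998, App. B.8.3 (v)] -/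
theorem chCoh_eq_of_hom {F : X.left.Modules} (R R' : StrictlyPerfectResolution F) (φ : R.P ⟶ R'.P)
    (hφ : φ ≫ R'.ε = R.ε) (k : ℕ) : chCoh C X F R k = chCoh C X F R' k := by
  rw [chCoh_def, chCoh_def, KZero.ofCoh_eq_of_hom R R' φ hφ]

/-- Transport along `F ≅ F'` does not change `ch_k` (same resolving complex). [cite: Fulton1998, §15.1] -/
theorem chCoh_ofIso {F F' : X.left.Modules} (R : StrictlyPerfectResolution F) (e : F ≅ F') (k : ℕ) :
    chCoh C X F' (R.ofIso e) k = chCoh C X F R k := rfl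

/-- `ch_k(F)` is a rational class. [cite: VoisinHodgeI2002, Thm. 11.23] -/
theorem isRationalClass_chCoh (F : X.left.Modules) (R : StrictlyPerfectResolution F) (k : ℕ) :
    IsRationalClass (chCoh C X F R k) :=
  isRationalClass_chKZero C X k _

/-- **On a smooth projective `X`, `ch_k(F)` is an ALGEBRAIC class.** [cite: Fulton1998, Prop. 19.1.2 and Cor. 19.2 (b)] -/
theorem chCoh_mem_algebraicClasses {n : ℕ} (hX : IsSmoothProjective n X) (F : X.left.Modules)
    (R : StrictlyPerfectResolution F) (k : ℕ) : chCoh C X F R k ∈ algebraicClasses X k :=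
  chKZero_mem_algebraicClasses C X hX k _

/-! ### §2 The cone resolution: `ch_k(E/F₁) = ch_k(E) − ch_k(F₁)` and `ch_k(ι_*𝒪_Z) = ch_k(𝒪_X) − ch_k(𝓘_Z)` (any `X`) -/

/-- **`ch_k(F₃) = ch_k(E) − ch_k(F₁)` on the cone resolution**: for `0 → F₁ → E → F₃ → 0` short exact with
`E` a vector bundle and `R` a resolution of `F₁` (`KZero.ofCoh_cone`). No hypothesis on `X`.
[cite: Fulton1998, §15.1 (with App. B.8.3 (iii))] -/
theorem chCoh_cone {S : ShortComplex X.left.Modules} (hS : S.ShortExact) (hE : IsFiniteLocallyFree S.X₂)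
    (R : StrictlyPerfectResolution S.X₁) (k : ℕ) :
    chCoh C X S.X₃ (R.cone hS hE) k = C.ch X S.X₂ k - chCoh C X S.X₁ R k := by
  rw [chCoh_def, chCoh_def, KZero.ofCoh_cone, map_sub, chKZero_of]

/-- Rearranged: `ch_k(E) = ch_k(F₁) + ch_k(F₃)` with `F₃` on the cone resolution.
[cite: Fulton1998, §15.1 (with App. B.8.3 (iii))] -/
theorem ch_eq_chCoh_add_chCoh_cone {S : ShortComplex X.left.Modules} (hS : S.ShortExact)
    (hE : IsFiniteLocallyFree S.X₂) (R : StrictlyPerfectResolution S.X₁) (k : ℕ) :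
    C.ch X S.X₂ k = chCoh C X S.X₁ R k + chCoh C X S.X₃ (R.cone hS hE) k := by
  rw [chCoh_cone, add_sub_cancel]

/-- **`ch_k(ι_*𝒪_Z) = ch_k(𝒪_X) − ch_k(𝓘_Z)` on the cone resolution**, for a closed immersion
`ι : Z → X` and ANY resolution `R` of `𝓘_Z` (`KZero.ofCoh_pushforward_unit_cone`; the short exact
sequence `0 → 𝓘_Z → 𝒪_X → ι_*𝒪_Z → 0`). No hypothesis on `X`.
[cite: Fulton1998, Example 15.1.5 (with §15.1)] -/
theorem chCoh_pushforward_unit_cone {Z : Scheme.{0}} (ι : Z ⟶ X.left) [IsClosedImmersion ι]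
    (R : StrictlyPerfectResolution (idealSheafOf ι)) (k : ℕ) :
    chCoh C X ((Scheme.Modules.pushforward ι).obj (unitModule Z))
        (StrictlyPerfectResolution.cone (S := idealSheafShortComplex ι) (shortExact_idealSheafOf ι)
          isFiniteLocallyFree_unitModule R) k =
      C.ch X (unitModule X.left) k - chCoh C X (idealSheafOf ι) R k :=
  chCoh_cone C X (S := idealSheafShortComplex ι) (shortExact_idealSheafOf ι) isFiniteLocallyFree_unitModule R k

/-! ### §3 Under Hartshorne III Ex. 6.9 (b): resolution independence, additivity, `ch_k(𝓘_Z)` on any resolutions -/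

section Fact

variable {X}
variable [IsNoetherian X.left] [IsIntegral X.left] [X.left.IsSeparated]

/-- **Resolution independence of `ch_k(F)`** for `F` coherent (`KZero.ofCoh_eq`).
[cite: Hartshorne1977, III Ex. 6.9 (b) (p. 239)] [cite: Fulton1998, §15.1 (with App. B.8.3 (v))] -/
theorem chCoh_eq (h : Hartshorne1977_eulerChar_resolution_shortExact.{0}) (hX : Scheme.IsRegular X.left)
    {F : X.left.Modules} (hF : Coh F) (R R' : StrictlyPerfectResolution F) (k : ℕ) :
    chCoh C X F R k = chCoh C X F R' k := by
  rw [chCoh_def, chCoh_def, Hartshorne1977_eulerChar_resolution_shortExact.ofCoh_eq h hX hF R R']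

/-- **Additivity of `ch_k` on short exact sequences of coherent sheaves**, on any resolutions
(`KZero.ofCoh_shortExact`). [cite: Hartshorne1977, III Ex. 6.9 (b) (p. 239)] [cite: Fulton1998, §15.1 (with App. B.8.3 (iii))] -/
theorem chCoh_shortExact (h : Hartshorne1977_eulerChar_resolution_shortExact.{0})
    (hX : Scheme.IsRegular X.left) {S : ShortComplex X.left.Modules} (hS : S.ShortExact) (h₁ : Coh S.X₁)
    (h₂ : Coh S.X₂) (h₃ : Coh S.X₃) (R₁ : StrictlyPerfectResolution S.X₁)
    (R₂ : StrictlyPerfectResolution S.X₂) (R₃ : StrictlyPerfectResolution S.X₃) (k : ℕ) :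
    chCoh C X S.X₂ R₂ k = chCoh C X S.X₁ R₁ k + chCoh C X S.X₃ R₃ k := by
  rw [chCoh_def, chCoh_def, chCoh_def,
    Hartshorne1977_eulerChar_resolution_shortExact.ofCoh_shortExact h hX hS h₁ h₂ h₃ R₁ R₂ R₃, map_add]

/-- **On ANY resolution of a vector bundle `E`, `ch_k(E)` is `C.ch X E k`.**
[cite: Hartshorne1977, III Ex. 6.9 (b) (p. 239)] [cite: Fulton1998, §15.1] -/
theorem chCoh_eq_ch (h : Hartshorne1977_eulerChar_resolution_shortExact.{0}) (hX : Scheme.IsRegular X.left)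
    {E : X.left.Modules} (hE : IsFiniteLocallyFree E) (hcoh : Coh E) (R : StrictlyPerfectResolution E)
    (k : ℕ) : chCoh C X E R k = C.ch X E k := by
  rw [chCoh_def, Hartshorne1977_eulerChar_resolution_shortExact.ofCoh_eq_of_isFiniteLocallyFree h hX hE
    hcoh R, chKZero_of]

/-- **`ch_k(ι_*𝒪_Z) = ch_k(𝒪_X) − ch_k(𝓘_Z)` on ANY resolutions** of `𝓘_Z` and `ι_*𝒪_Z`, for a closed
immersion `ι : Z → X`. [cite: Hartshorne1977, III Ex. 6.9 (b) (p. 239) with II Prop. 5.9] [cite: Fulton1998, Example 15.1.5] -/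
theorem chCoh_pushforward_unit_eq (h : Hartshorne1977_eulerChar_resolution_shortExact.{0})
    (hX : Scheme.IsRegular X.left) {Z : Scheme.{0}} (ι : Z ⟶ X.left) [IsClosedImmersion ι]
    (R : StrictlyPerfectResolution (idealSheafOf ι))
    (R' : StrictlyPerfectResolution ((Scheme.Modules.pushforward ι).obj (unitModule Z))) (k : ℕ) :
    chCoh C X _ R' k = C.ch X (unitModule X.left) k - chCoh C X (idealSheafOf ι) R k := by
  rw [chCoh_def, chCoh_def, Hartshorne1977_eulerChar_resolution_shortExact.ofCoh_pushforward_unit_eq h hX ι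
    isFiniteLocallyFree_unitModule R R', map_sub, chKZero_of]

/-- **`ch_k(𝓘_Z) = ch_k(𝒪_X) − ch_k(ι_*𝒪_Z)` on ANY resolutions** (the headline of (K-coh)).
[cite: Hartshorne1977, III Ex. 6.9 (b) (p. 239) with II Prop. 5.9] [cite: Fulton1998, Example 15.1.5] -/
theorem chCoh_idealSheafOf_eq (h : Hartshorne1977_eulerChar_resolution_shortExact.{0})
    (hX : Scheme.IsRegular X.left) {Z : Scheme.{0}} (ι : Z ⟶ X.left) [IsClosedImmersion ι]
    (R : StrictlyPerfectResolution (idealSheafOf ι))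
    (R' : StrictlyPerfectResolution ((Scheme.Modules.pushforward ι).obj (unitModule Z))) (k : ℕ) :
    chCoh C X (idealSheafOf ι) R k = C.ch X (unitModule X.left) k - chCoh C X _ R' k := by
  rw [chCoh_pushforward_unit_eq C h hX ι R R', sub_sub_cancel]

end Fact

end ChernCharacterCoherent

/-! ### §4 Abelian varieties over `ℂ` and the translates `𝒵 = ⋃ (W₁ + a_j)` of an Abel–Jacobi curve -/

end Literature.AlgebraicGeometry.HodgeTheory

namespace Literature.AlgebraicGeometry.Motives

open Literature.AlgebraicGeometry.HodgeTheory Literature.AlgebraicGeometry.Modules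
  Literature.AlgebraicGeometry.Morphisms Literature.AlgebraicGeometry.Resolution

namespace AbelianVariety

variable (C : ChernCharacterBetti) (A : AbelianVariety ℂ)

/-- **Resolution independence of `ch_k(F)` on a complex abelian variety**, under Hartshorne III Ex. 6.9 (b)
alone (noetherian `isNoetherian_left`, integral `isIntegral_left`, separated `isSeparated_left`, regular
`isRegular_left` are discharged). [cite: Hartshorne1977, III Ex. 6.9 (b) (p. 239)] -/
theorem chCoh_eq (h : Hartshorne1977_eulerChar_resolution_shortExact.{0}) {F : A.X.left.Modules}
    (hF : Coh F) (R R' : StrictlyPerfectResolution F) (k : ℕ) :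
    chCoh C A.X F R k = chCoh C A.X F R' k :=
  haveI := A.isNoetherian_left
  haveI := A.isIntegral_left
  HodgeTheory.chCoh_eq C h A.isRegular_left hF R R' k

/-- **Additivity of `ch_k` on short exact sequences of coherent sheaves on a complex abelian variety.**
[cite: Hartshorne1977, III Ex. 6.9 (b) (p. 239)] -/
theorem chCoh_shortExact (h : Hartshorne1977_eulerChar_resolution_shortExact.{0})
    {S : ShortComplex A.X.left.Modules} (hS : S.ShortExact) (h₁ : Coh S.X₁) (h₂ : Coh S.X₂) (h₃ : Coh S.X₃)
    (R₁ : StrictlyPerfectResolution S.X₁) (R₂ : StrictlyPerfectResolution S.X₂)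
    (R₃ : StrictlyPerfectResolution S.X₃) (k : ℕ) :
    chCoh C A.X S.X₂ R₂ k = chCoh C A.X S.X₁ R₁ k + chCoh C A.X S.X₃ R₃ k :=
  haveI := A.isNoetherian_left
  haveI := A.isIntegral_left
  HodgeTheory.chCoh_shortExact C h A.isRegular_left hS h₁ h₂ h₃ R₁ R₂ R₃ k

/-- **`ch_k(𝓘_Z) = ch_k(𝒪_A) − ch_k(ι_*𝒪_Z)` on a complex abelian variety**, any resolutions, for a closed
subscheme `ι : Z → A`. [cite: Hartshorne1977, III Ex. 6.9 (b) (p. 239) with II Prop. 5.9] -/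
theorem chCoh_idealSheafOf_eq (h : Hartshorne1977_eulerChar_resolution_shortExact.{0}) {Z : Scheme.{0}}
    (ι : Z ⟶ A.X.left) [IsClosedImmersion ι] (R : StrictlyPerfectResolution (idealSheafOf ι))
    (R' : StrictlyPerfectResolution ((Scheme.Modules.pushforward ι).obj (unitModule Z))) (k : ℕ) :
    chCoh C A.X (idealSheafOf ι) R k = C.ch A.X (unitModule A.X.left) k - chCoh C A.X _ R' k :=
  haveI := A.isNoetherian_left
  haveI := A.isIntegral_left
  HodgeTheory.chCoh_idealSheafOf_eq C h A.isRegular_left ι R R' k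

end AbelianVariety

namespace Jacobian

variable (C : ChernCharacterBetti) {Γ : SchemeOver ℂ} (𝒥 : Jacobian Γ)

/-- **`ch_k(ι_*𝒪_𝒵) = ch_k(𝒪_J) − ch_k(𝓘_𝒵)` for the translates `𝒵 = ⋃_{s ∈ S} (W₁ + s)` of the
Abel–Jacobi curve in its Jacobian**, `ι = ajTranslatesι` a closed immersion (e.g.
`isClosedImmersion_ajTranslatesι`), for ANY resolution `R` of `𝓘_𝒵 = ajTranslatesIdeal P S` and
`ι_*𝒪_𝒵` on the cone resolution — no fact needed. [cite: Fulton1998, Example 15.1.5 (with §15.1)] -/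
theorem chCoh_ajTranslatesIdeal_cone (P : AlgPoints Γ ℂ) (S : Finset (𝒥.J.Points ℂ))
    (hι : IsClosedImmersion (𝒥.ajTranslatesι P S)) (R : StrictlyPerfectResolution (𝒥.ajTranslatesIdeal P S))
    (k : ℕ) :
    chCoh C 𝒥.J.X ((Scheme.Modules.pushforward (𝒥.ajTranslatesι P S)).obj (unitModule _))
        (StrictlyPerfectResolution.cone (S := idealSheafShortComplex (𝒥.ajTranslatesι P S))
          (shortExact_idealSheafOf _) isFiniteLocallyFree_unitModule R) k =
      C.ch 𝒥.J.X (unitModule 𝒥.J.X.left) k - chCoh C 𝒥.J.X (𝒥.ajTranslatesIdeal P S) R k :=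
  chCoh_pushforward_unit_cone C 𝒥.J.X (𝒥.ajTranslatesι P S) R k

/-- **`ch_k(𝓘_𝒵) = ch_k(𝒪_J) − ch_k(ι_*𝒪_𝒵)` on ANY resolutions**, under Hartshorne III Ex. 6.9 (b)
(the Jacobian is an abelian variety: noetherian, integral, separated, regular discharged).
[cite: Hartshorne1977, III Ex. 6.9 (b) (p. 239) with II Prop. 5.9] [cite: Milne1986JacobianVarieties, §2 Prop. 2.3 (p. 173)] -/
theorem chCoh_ajTranslatesIdeal_eq (h : Hartshorne1977_eulerChar_resolution_shortExact.{0})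
    (P : AlgPoints Γ ℂ) (S : Finset (𝒥.J.Points ℂ)) (hι : IsClosedImmersion (𝒥.ajTranslatesι P S))
    (R : StrictlyPerfectResolution (𝒥.ajTranslatesIdeal P S))
    (R' : StrictlyPerfectResolution ((Scheme.Modules.pushforward (𝒥.ajTranslatesι P S)).obj (unitModule _)))
    (k : ℕ) :
    chCoh C 𝒥.J.X (𝒥.ajTranslatesIdeal P S) R k =
      C.ch 𝒥.J.X (unitModule 𝒥.J.X.left) k - chCoh C 𝒥.J.X _ R' k :=
  𝒥.J.chCoh_idealSheafOf_eq C h (𝒥.ajTranslatesι P S) R R' k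

end Jacobian

end Literature.AlgebraicGeometry.Motives

end
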